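import Summits.AtomisticToContinuum.Crystallization.Theorems.ChartedZeroExcessLayeredLatticeLiouvilleZZA
import Summits.AtomisticToContinuum.Crystallization.Theorems.ChartedZeroExcessLayeredLatticeLiouvilleZZB

/-!
# Charted zero-excess layered lattices — Part ZZS: NORMALISATION of the target chart (B′.5, index side)

Route `ChartedPlanarOrder`, station L2′.  Part ZZR (`exists_slabIso_of_window`) consumes link maps that
are NORMALISED: `CapType τ g x ∧ UpSign τ g x 1 ∧ (g x).1 = x.1` on the window.  Parts ZW/ZX/ZY/ZZA/ZZB
proved that raw link maps on a Barlow-connected window become normalised after composing `g` with ONE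
relabelling `σ` of the target index set: `σ = θ ∘ φ`, `φ ∈ {id, resliceInv b f}` (Part ZZA
`exists_aut_layerLaw`: re-slice an all-`c` target along the source's sheet family), `θ ∈ {shiftIdx L,
flipIdx ∘ shiftIdx L}` (Part ZZB `exists_relabel_fst`: fix the orientation sign and the sheet offset).

This part PACKAGES that as one statement about CHARTS, in the shape the junction (Part ZZP) and LEMMA Θ
(Part ZZR) consume: from a bond chart `(Φ, D, τ')` of the target configuration `C` and raw link maps
`g` on `W` (and next to `W`) it produces
* a two-sided inverse pair `σ, σ'` and new letters `τ''`,
* a set `Rs` of READABLE target sheets containing every sheet `(g z).1`, `(g z).1 - 1` (`z ∈ W`)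
  (all sheets, or — in the re-sliced branch — the sheets of letter `b`),
* adjacency transport `BarlowAdj τ'' (σ p) (σ q) ↔ BarlowAdj τ' p q` for `p.1, q.1 ∈ Rs`,
* the RE-INDEXED CHART `IsBarlowBondChart C {y | σ' y ∈ D ∧ (σ' y).1 ∈ Rs} (Φ ∘ σ') τ''` naming the
  same atoms (`(Φ ∘ σ') (σ (g z)) = Φ (g z)`),
* NORMALISED link maps `σ ∘ g` on the inner window `W'` with respect to `τ''`.
No metric, no new definitions; every transport is one of the tree's `barlowAdj_*_iff` lemmas.
-/

open Summit.AtomisticToContinuum.Crystallization.Theorems.ChartedPlanarOrderRigidityDoor (E3)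

namespace Summit.AtomisticToContinuum.Crystallization.Theorems.ChartedZeroExcessLayeredLatticeLiouville

/-! ### ZZS-1  Transport under target relabellings -/

/-- a link map composed with an automorphism of the target Barlow graphs stays a link map. -/
theorem IsLinkMap.transport {τ τ' τ'' : ℤ → Bool} {g σ : ℤ × ℤ × ℤ → ℤ × ℤ × ℤ} {x : ℤ × ℤ × ℤ}
    (h : IsLinkMap τ τ' g x) (hσ : ∀ p q, BarlowAdj τ'' (σ p) (σ q) ↔ BarlowAdj τ' p q)
    (hinj : Function.Injective σ) : IsLinkMap τ τ'' (σ ∘ g) x := by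
  refine ⟨fun i => ?_, fun i j => ?_, hinj.comp h.2.2⟩
  · rw [Function.comp_apply, Function.comp_apply, hσ]
    exact h.1 i
  · rw [h.2.1 i j, Function.comp_apply, Function.comp_apply, hσ]

/-- cap type is preserved by any relabelling that reflects equality of sheets. -/
theorem CapType.transport {τ : ℤ → Bool} {g σ : ℤ × ℤ × ℤ → ℤ × ℤ × ℤ} {x : ℤ × ℤ × ℤ} (h : CapType τ g x)
    (hσ : ∀ p q : ℤ × ℤ × ℤ, (σ p).1 = (σ q).1 → p.1 = q.1) : CapType τ (σ ∘ g) x :=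
  fun i hi e => h i hi (hσ _ _ e)

/-- the layer shift keeps the orientation sign. -/
theorem UpSign.shift {τ : ℤ → Bool} {g : ℤ × ℤ × ℤ → ℤ × ℤ × ℤ} {x : ℤ × ℤ × ℤ} {s : ℤ} (L : ℤ)
    (h : UpSign τ g x s) : UpSign τ (shiftIdx L ∘ g) x s := by
  refine ⟨fun i hi hi' => ?_, fun i hi => ?_⟩
  · simp only [Function.comp_apply, shiftIdx, h.1 i hi hi']
    ring
  · simp only [Function.comp_apply, shiftIdx, h.2 i hi]
    ring

/-- the flip reverses the orientation sign. -/
theorem UpSign.flip {τ : ℤ → Bool} {g : ℤ × ℤ × ℤ → ℤ × ℤ × ℤ} {x : ℤ × ℤ × ℤ} {s : ℤ}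
    (h : UpSign τ g x s) : UpSign τ (flipIdx ∘ g) x (-s) := by
  refine ⟨fun i hi hi' => ?_, fun i hi => ?_⟩
  · simp only [Function.comp_apply, flipIdx, h.1 i hi hi']
    ring
  · simp only [Function.comp_apply, flipIdx, h.2 i hi]
    ring

/-- `shiftIdx L` is injective (lane docstring, hand-2 g39). -/
theorem shiftIdx_injective (L : ℤ) : Function.Injective (shiftIdx L) :=
  fun p q h => by rw [← unshiftIdx_shiftIdx L p, h, unshiftIdx_shiftIdx]

/-- restricting the domain of a bond chart. -/
theorem IsBarlowBondChart.restrict {C : Set E3} {D D' : Set (ℤ × ℤ × ℤ)} {Φ : ℤ × ℤ × ℤ → E3} {τ : ℤ → Bool}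
    (h : IsBarlowBondChart C D Φ τ) (hD : D' ⊆ D) : IsBarlowBondChart C D' Φ τ :=
  ⟨h.1.mono hD, h.2.1.mono_left hD, fun x hx y hy => h.2.2 x (hD hx) y (hD hy)⟩

/-- CHART TRANSPORT: re-indexing a bond chart by a relabelling `σ` (two-sided inverse `σ'`) that is an
isomorphism of Barlow graphs `B_τ' → B_τ''` on the domain. The new index `y` names the atom of old index
`σ' y`. -/
theorem IsBarlowBondChart.transport {C : Set E3} {D : Set (ℤ × ℤ × ℤ)} {Φ : ℤ × ℤ × ℤ → E3}
    {τ' τ'' : ℤ → Bool} {σ σ' : ℤ × ℤ × ℤ → ℤ × ℤ × ℤ} (h : IsBarlowBondChart C D Φ τ')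
    (hσσ' : ∀ p, σ (σ' p) = p) (hσ : ∀ p ∈ D, ∀ q ∈ D, (BarlowAdj τ'' (σ p) (σ q) ↔ BarlowAdj τ' p q)) :
    IsBarlowBondChart C {y | σ' y ∈ D} (Φ ∘ σ') τ'' := by
  have hinj' : Function.Injective σ' := fun p q e => by rw [← hσσ' p, e, hσσ']
  obtain ⟨hinj, hmaps, hbond⟩ := h
  refine ⟨fun y hy y' hy' e => hinj' (hinj hy hy' e), fun y hy => hmaps hy, fun y hy y' hy' => ?_⟩
  rw [Function.comp_apply, Function.comp_apply, hbond _ hy _ hy', ← hσ _ hy _ hy', hσσ', hσσ']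

/-! ### ZZS-2  Stage A: the letter / slicing fix (Part ZZA packaged with its transports) -/

/-- STAGE A.  After `φ ∈ {id, resliceInv b f}` the link maps are cap-type with one orientation sign and an
affine layer law on the inner window; `φ` is a Barlow isomorphism on the READABLE sheets `Rs` (all
sheets, resp. the sheets of letter `b`), and every sheet read by the window is readable. -/
theorem exists_letter_fix {τ τ' : ℤ → Bool} {g : ℤ × ℤ × ℤ → ℤ × ℤ × ℤ} {W W' : Set (ℤ × ℤ × ℤ)}
    (hmaps : ∀ z ∈ W, IsLinkMap τ τ' g z) (hnb : ∀ z ∈ W, ∀ i, IsLinkMap τ τ' g (linkPt τ z i))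
    (hW'W : W' ⊆ W) (hW'1 : ∀ z ∈ W', ∀ i, linkPt τ z i ∈ W) {y : ℤ × ℤ × ℤ} (hy : y ∈ W')
    (hconn : ∀ x ∈ W, Relation.ReflTransGen (fun a b => a ∈ W ∧ b ∈ W ∧ BarlowAdj τ a b) y x)
    (hconn' : ∀ x ∈ W', Relation.ReflTransGen (fun a b => a ∈ W' ∧ b ∈ W' ∧ BarlowAdj τ a b) y x) :
    ∃ (φ φ' : ℤ × ℤ × ℤ → ℤ × ℤ × ℤ) (τ₁ : ℤ → Bool) (Rs : Set ℤ) (s L : ℤ), (s = 1 ∨ s = -1) ∧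
      (∀ p, φ' (φ p) = p) ∧ (∀ p, φ (φ' p) = p) ∧
      (∀ p q : ℤ × ℤ × ℤ, p.1 ∈ Rs → q.1 ∈ Rs → (BarlowAdj τ₁ (φ p) (φ q) ↔ BarlowAdj τ' p q)) ∧
      (∀ m : ℤ, (∃ z ∈ W, (g z).1 = m ∨ (g z).1 - 1 = m) → m ∈ Rs) ∧
      ∀ z ∈ W', IsLinkMap τ τ₁ (φ ∘ g) z ∧ CapType τ (φ ∘ g) z ∧ UpSign τ (φ ∘ g) z s ∧
        ((φ ∘ g) z).1 - s * z.1 = L := by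
  obtain ⟨φ, s, hφ, hs, hW, -⟩ := exists_aut_layerLaw hmaps hnb hW'W hW'1 hy hconn hconn'
  rcases hφ with rfl | ⟨b, f, hb, rfl⟩
  · exact ⟨id, id, τ', Set.univ, s, ((id ∘ g) y).1 - s * y.1, hs, fun _ => rfl, fun _ => rfl,
      fun p q _ _ => Iff.rfl, fun m _ => Set.mem_univ m, fun z hz => ⟨hmaps z (hW'W hz), hW z hz⟩⟩
  · refine ⟨resliceInv b f, reslice b f, fun _ => b, {m | τ' m = b}, s,
      ((resliceInv b f ∘ g) y).1 - s * y.1, hs, reslice_resliceInv b f, resliceInv_reslice b f,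
      fun p q hp hq => (barlowAdj_resliceInv_iff b f p q).trans
        (barlowAdj_congr (τ := τ') (τ'' := fun _ => b) hp hq).symm,
      fun m hm => ?_, fun z hz => ⟨?_, hW z hz⟩⟩
    · obtain ⟨z, hz, h | h⟩ := hm
      · rw [Set.mem_setOf_eq, ← h]
        exact (hb z hz).2
      · rw [Set.mem_setOf_eq, ← h]
        exact (hb z hz).1
    · exact ((hmaps z (hW'W hz)).toConst (hb z (hW'W hz)).1 (hb z (hW'W hz)).2).reslice f

/-! ### ZZS-3  Stage B: the orientation / offset fix (Part ZZB packaged with its transports) -/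

/-- STAGE B.  `θ = shiftIdx L` (`s = 1`) or `θ = flipIdx ∘ shiftIdx L` (`s = -1`) is a Barlow isomorphism
`B_τ₁ ≅ B_τ₂` making the link maps upward (`UpSign … 1`) and sheet-aligned. -/
theorem exists_sign_fix {τ τ₁ : ℤ → Bool} {G : ℤ × ℤ × ℤ → ℤ × ℤ × ℤ} {W' : Set (ℤ × ℤ × ℤ)} {s L : ℤ}
    (hs : s = 1 ∨ s = -1)
    (hW : ∀ z ∈ W', IsLinkMap τ τ₁ G z ∧ CapType τ G z ∧ UpSign τ G z s ∧ (G z).1 - s * z.1 = L) :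
    ∃ (θ θ' : ℤ × ℤ × ℤ → ℤ × ℤ × ℤ) (τ₂ : ℤ → Bool), (∀ p, θ' (θ p) = p) ∧ (∀ p, θ (θ' p) = p) ∧
      (∀ p q, BarlowAdj τ₂ (θ p) (θ q) ↔ BarlowAdj τ₁ p q) ∧
      ∀ z ∈ W', IsLinkMap τ τ₂ (θ ∘ G) z ∧ CapType τ (θ ∘ G) z ∧ UpSign τ (θ ∘ G) z 1 ∧
        ((θ ∘ G) z).1 = z.1 := by
  rcases hs with rfl | rfl
  · refine ⟨shiftIdx L, unshiftIdx L, shiftLetters L τ₁, unshiftIdx_shiftIdx L, shiftIdx_unshiftIdx L,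
      barlowAdj_shiftIdx_iff L τ₁, fun z hz => ?_⟩
    obtain ⟨hl, hc, hu, hL⟩ := hW z hz
    exact ⟨hl.transport (barlowAdj_shiftIdx_iff L τ₁) (shiftIdx_injective L),
      hc.transport fun p q e => by simp only [shiftIdx] at e; omega, hu.shift L,
      shiftIdx_fst_of_layerLaw hL⟩
  · have hiff : ∀ p q, BarlowAdj (flipLetters (shiftLetters L τ₁)) ((flipIdx ∘ shiftIdx L) p)
        ((flipIdx ∘ shiftIdx L) q) ↔ BarlowAdj τ₁ p q := fun p q => by
      rw [Function.comp_apply, Function.comp_apply, barlowAdj_flip_iff, barlowAdj_shiftIdx_iff]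
    refine ⟨flipIdx ∘ shiftIdx L, unshiftIdx L ∘ flipIdx, flipLetters (shiftLetters L τ₁),
      fun p => by simp [flipIdx_flipIdx, unshiftIdx_shiftIdx],
      fun p => by simp [shiftIdx_unshiftIdx, flipIdx_flipIdx], hiff, fun z hz => ?_⟩
    obtain ⟨hl, hc, hu, hL⟩ := hW z hz
    refine ⟨hl.transport hiff (flipIdx_injective.comp (shiftIdx_injective L)),
      hc.transport fun p q e => by simp only [Function.comp_apply, flipIdx, shiftIdx] at e; omega,
      ?_, flipIdx_shiftIdx_fst_of_layerLaw hL⟩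
    have h := (hu.shift L).flip
    show UpSign τ (flipIdx ∘ (shiftIdx L ∘ G)) z 1
    simpa using h

/-! ### ZZS-4  ★★★ The normalised chart -/

/-- ★★★ **NORMALISATION.**  From a bond chart `(Φ, D, τ')` of `C` and raw link maps `g` (w.r.t. `τ'`) on a
Barlow-connected window `W` and at its neighbours, with a Barlow-connected inner window `W' ⊆ W` whose
links lie in `W`: a relabelling `σ` of `ℤ × ℤ × ℤ` with two-sided inverse `σ'`, new letters `τ''`, and a
set `Rs` of READABLE sheets such that
1. `σ' ∘ σ = id = σ ∘ σ'`;
2. `σ` is a Barlow isomorphism `B_τ' → B_τ''` between sites of readable sheets;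
3. every target sheet read by the window (`(g z).1`, `(g z).1 - 1`, `z ∈ W`) is readable;
4. `Φ ∘ σ'` is a bond chart of `C` on `{y | σ' y ∈ D, (σ' y).1 ∈ Rs}` with letters `τ''`;
5. it names the same atoms: `(Φ ∘ σ') (σ (g z)) = Φ (g z)`;
6. `σ ∘ g` is a NORMALISED link map at every site of `W'`:
   `IsLinkMap τ τ'' (σ ∘ g) z ∧ CapType τ (σ ∘ g) z ∧ UpSign τ (σ ∘ g) z 1 ∧ ((σ ∘ g) z).1 = z.1`
   — exactly the hypotheses `hlm`, `hlaw` of Part ZZR `exists_slabIso_of_window`. -/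
theorem exists_normalised_chart {C : Set E3} {D : Set (ℤ × ℤ × ℤ)} {Φ : ℤ × ℤ × ℤ → E3}
    {τ τ' : ℤ → Bool} {g : ℤ × ℤ × ℤ → ℤ × ℤ × ℤ} {W W' : Set (ℤ × ℤ × ℤ)}
    (hΦ : IsBarlowBondChart C D Φ τ') (hmaps : ∀ z ∈ W, IsLinkMap τ τ' g z)
    (hnb : ∀ z ∈ W, ∀ i, IsLinkMap τ τ' g (linkPt τ z i)) (hW'W : W' ⊆ W)
    (hW'1 : ∀ z ∈ W', ∀ i, linkPt τ z i ∈ W) {y : ℤ × ℤ × ℤ} (hy : y ∈ W')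
    (hconn : ∀ x ∈ W, Relation.ReflTransGen (fun a b => a ∈ W ∧ b ∈ W ∧ BarlowAdj τ a b) y x)
    (hconn' : ∀ x ∈ W', Relation.ReflTransGen (fun a b => a ∈ W' ∧ b ∈ W' ∧ BarlowAdj τ a b) y x) :
    ∃ (σ σ' : ℤ × ℤ × ℤ → ℤ × ℤ × ℤ) (τ'' : ℤ → Bool) (Rs : Set ℤ),
      (∀ p, σ' (σ p) = p) ∧ (∀ p, σ (σ' p) = p) ∧
      (∀ p q : ℤ × ℤ × ℤ, p.1 ∈ Rs → q.1 ∈ Rs → (BarlowAdj τ'' (σ p) (σ q) ↔ BarlowAdj τ' p q)) ∧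
      (∀ m : ℤ, (∃ z ∈ W, (g z).1 = m ∨ (g z).1 - 1 = m) → m ∈ Rs) ∧
      IsBarlowBondChart C {y' | σ' y' ∈ D ∧ (σ' y').1 ∈ Rs} (Φ ∘ σ') τ'' ∧
      (∀ z, (Φ ∘ σ') ((σ ∘ g) z) = Φ (g z)) ∧
      ∀ z ∈ W', IsLinkMap τ τ'' (σ ∘ g) z ∧ CapType τ (σ ∘ g) z ∧ UpSign τ (σ ∘ g) z 1 ∧
        ((σ ∘ g) z).1 = z.1 := by
  obtain ⟨φ, φ', τ₁, Rs, s, L, hs, h1, h2, hiff, hRs, hW⟩ :=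
    exists_letter_fix hmaps hnb hW'W hW'1 hy hconn hconn'
  obtain ⟨θ, θ', τ₂, h3, h4, hiff2, hW2⟩ := exists_sign_fix hs hW
  have hD : IsBarlowBondChart C {y' | y' ∈ D ∧ y'.1 ∈ Rs} Φ τ' := hΦ.restrict fun y' hy' => hy'.1
  refine ⟨θ ∘ φ, φ' ∘ θ', τ₂, Rs, fun p => by simp [h3, h1], fun p => by simp [h2, h4],
    fun p q hp hq => (hiff2 _ _).trans (hiff p q hp hq), hRs,
    hD.transport (σ := θ ∘ φ) (σ' := φ' ∘ θ') (fun p => by simp [h2, h4])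
      fun p hp q hq => (hiff2 _ _).trans (hiff p q hp.2 hq.2),
    fun z => by simp [h3, h1], fun z hz => hW2 z hz⟩

/-! ### v2 (lens-2 g81 ZZS v2, 9844a679d681c230): ONE-SIDED readability guard — APPENDED under primed names
(the gate's `theorems.append-only` forbids mutating the landed v1 statements; v1 above is superseded, not wrong). -/

/-- STAGE A.  After `φ ∈ {id, resliceInv b f}` the link maps are cap-type with one orientation sign and an
affine layer law on the inner window; `φ` is a Barlow isomorphism at every site whose two read sheets
`p.1, p.1 - 1` are READABLE (`Rs`: all sheets, resp. the sheets of letter `b`), and every sheet read by the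
window is readable. -/
theorem exists_letter_fix' {τ τ' : ℤ → Bool} {g : ℤ × ℤ × ℤ → ℤ × ℤ × ℤ} {W W' : Set (ℤ × ℤ × ℤ)}
    (hmaps : ∀ z ∈ W, IsLinkMap τ τ' g z) (hnb : ∀ z ∈ W, ∀ i, IsLinkMap τ τ' g (linkPt τ z i))
    (hW'W : W' ⊆ W) (hW'1 : ∀ z ∈ W', ∀ i, linkPt τ z i ∈ W) {y : ℤ × ℤ × ℤ} (hy : y ∈ W')
    (hconn : ∀ x ∈ W, Relation.ReflTransGen (fun a b => a ∈ W ∧ b ∈ W ∧ BarlowAdj τ a b) y x)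
    (hconn' : ∀ x ∈ W', Relation.ReflTransGen (fun a b => a ∈ W' ∧ b ∈ W' ∧ BarlowAdj τ a b) y x) :
    ∃ (φ φ' : ℤ × ℤ × ℤ → ℤ × ℤ × ℤ) (τ₁ : ℤ → Bool) (Rs : Set ℤ) (s L : ℤ), (s = 1 ∨ s = -1) ∧
      (∀ p, φ' (φ p) = p) ∧ (∀ p, φ (φ' p) = p) ∧
      (∀ p q : ℤ × ℤ × ℤ, p.1 ∈ Rs → p.1 - 1 ∈ Rs → (BarlowAdj τ₁ (φ p) (φ q) ↔ BarlowAdj τ' p q)) ∧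
      (∀ m : ℤ, (∃ z ∈ W, (g z).1 = m ∨ (g z).1 - 1 = m) → m ∈ Rs) ∧
      (Rs = Set.univ ∨ ∃ b : Bool, Rs = {m | τ' m = b}) ∧
      ∀ z ∈ W', IsLinkMap τ τ₁ (φ ∘ g) z ∧ CapType τ (φ ∘ g) z ∧ UpSign τ (φ ∘ g) z s ∧
        ((φ ∘ g) z).1 - s * z.1 = L := by
  obtain ⟨φ, s, hφ, hs, hW, -⟩ := exists_aut_layerLaw hmaps hnb hW'W hW'1 hy hconn hconn'
  rcases hφ with rfl | ⟨b, f, hb, rfl⟩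
  · exact ⟨id, id, τ', Set.univ, s, ((id ∘ g) y).1 - s * y.1, hs, fun _ => rfl, fun _ => rfl,
      fun p q _ _ => Iff.rfl, fun m _ => Set.mem_univ m, Or.inl rfl,
      fun z hz => ⟨hmaps z (hW'W hz), hW z hz⟩⟩
  · refine ⟨resliceInv b f, reslice b f, fun _ => b, {m | τ' m = b}, s,
      ((resliceInv b f ∘ g) y).1 - s * y.1, hs, reslice_resliceInv b f, resliceInv_reslice b f,
      fun p q hp hp' => (barlowAdj_resliceInv_iff b f p q).trans
        (barlowAdj_congr_of (τ := τ') (τ'' := fun _ => b) (fun _ => hp) fun e => by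
          rw [show q.1 = p.1 - 1 by omega]; exact hp').symm,
      fun m hm => ?_, Or.inr ⟨b, rfl⟩, fun z hz => ⟨?_, hW z hz⟩⟩
    · obtain ⟨z, hz, h | h⟩ := hm
      · rw [Set.mem_setOf_eq, ← h]
        exact (hb z hz).2
      · rw [Set.mem_setOf_eq, ← h]
        exact (hb z hz).1
    · exact ((hmaps z (hW'W hz)).toConst (hb z (hW'W hz)).1 (hb z (hW'W hz)).2).reslice f

/-- ★★★ **NORMALISATION.**  From a bond chart `(Φ, D, τ')` of `C` and raw link maps `g` (w.r.t. `τ'`) on a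
Barlow-connected window `W` and at its neighbours, with a Barlow-connected inner window `W' ⊆ W` whose
links lie in `W`: a relabelling `σ` of `ℤ × ℤ × ℤ` with two-sided inverse `σ'`, new letters `τ''`, and a
set `Rs` of READABLE sheets such that
1. `σ' ∘ σ = id = σ ∘ σ'`;
2. ONE-SIDED TRANSPORT: `σ` is a Barlow isomorphism `B_τ' → B_τ''` at every site `p` whose two read
   sheets `p.1, p.1 - 1` are readable — against ALL `q` (a Barlow edge reads the letter below it only);
3. every target sheet read by the window (`(g z).1`, `(g z).1 - 1`, `z ∈ W`) is readable;
4. `Φ ∘ σ'` is a bond chart of `C` on `{y | σ' y ∈ D, (σ' y).1 ∈ Rs, (σ' y).1 - 1 ∈ Rs}` (letters `τ''`);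
5. it names the same atoms: `(Φ ∘ σ') (σ (g z)) = Φ (g z)`;
6. `σ ∘ g` is a NORMALISED link map at every site of `W'`:
   `IsLinkMap τ τ'' (σ ∘ g) z ∧ CapType τ (σ ∘ g) z ∧ UpSign τ (σ ∘ g) z 1 ∧ ((σ ∘ g) z).1 = z.1`
   — exactly the hypotheses `hlm`, `hlaw` of Part ZZR `exists_slabIso_of_window`;
7. the branch record: `Rs = univ` (generic target) or `Rs = {m | τ' m = b}` (re-sliced all-`b` target). -/
theorem exists_normalised_chart' {C : Set E3} {D : Set (ℤ × ℤ × ℤ)} {Φ : ℤ × ℤ × ℤ → E3}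
    {τ τ' : ℤ → Bool} {g : ℤ × ℤ × ℤ → ℤ × ℤ × ℤ} {W W' : Set (ℤ × ℤ × ℤ)}
    (hΦ : IsBarlowBondChart C D Φ τ') (hmaps : ∀ z ∈ W, IsLinkMap τ τ' g z)
    (hnb : ∀ z ∈ W, ∀ i, IsLinkMap τ τ' g (linkPt τ z i)) (hW'W : W' ⊆ W)
    (hW'1 : ∀ z ∈ W', ∀ i, linkPt τ z i ∈ W) {y : ℤ × ℤ × ℤ} (hy : y ∈ W')
    (hconn : ∀ x ∈ W, Relation.ReflTransGen (fun a b => a ∈ W ∧ b ∈ W ∧ BarlowAdj τ a b) y x)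
    (hconn' : ∀ x ∈ W', Relation.ReflTransGen (fun a b => a ∈ W' ∧ b ∈ W' ∧ BarlowAdj τ a b) y x) :
    ∃ (σ σ' : ℤ × ℤ × ℤ → ℤ × ℤ × ℤ) (τ'' : ℤ → Bool) (Rs : Set ℤ),
      (∀ p, σ' (σ p) = p) ∧ (∀ p, σ (σ' p) = p) ∧
      (∀ p q : ℤ × ℤ × ℤ, p.1 ∈ Rs → p.1 - 1 ∈ Rs → (BarlowAdj τ'' (σ p) (σ q) ↔ BarlowAdj τ' p q)) ∧
      (∀ m : ℤ, (∃ z ∈ W, (g z).1 = m ∨ (g z).1 - 1 = m) → m ∈ Rs) ∧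
      IsBarlowBondChart C {y' | σ' y' ∈ D ∧ (σ' y').1 ∈ Rs ∧ (σ' y').1 - 1 ∈ Rs} (Φ ∘ σ') τ'' ∧
      (∀ z, (Φ ∘ σ') ((σ ∘ g) z) = Φ (g z)) ∧
      (∀ z ∈ W', IsLinkMap τ τ'' (σ ∘ g) z ∧ CapType τ (σ ∘ g) z ∧ UpSign τ (σ ∘ g) z 1 ∧
        ((σ ∘ g) z).1 = z.1) ∧
      (Rs = Set.univ ∨ ∃ b : Bool, Rs = {m | τ' m = b}) := by
  obtain ⟨φ, φ', τ₁, Rs, s, L, hs, h1, h2, hiff, hRs, hbr, hW⟩ :=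
    exists_letter_fix' hmaps hnb hW'W hW'1 hy hconn hconn'
  obtain ⟨θ, θ', τ₂, h3, h4, hiff2, hW2⟩ := exists_sign_fix hs hW
  have hD : IsBarlowBondChart C {y' | y' ∈ D ∧ y'.1 ∈ Rs ∧ y'.1 - 1 ∈ Rs} Φ τ' :=
    hΦ.restrict fun y' hy' => hy'.1
  refine ⟨θ ∘ φ, φ' ∘ θ', τ₂, Rs, fun p => by simp [h3, h1], fun p => by simp [h2, h4],
    fun p q hp hp' => (hiff2 _ _).trans (hiff p q hp hp'), hRs,
    hD.transport (σ := θ ∘ φ) (σ' := φ' ∘ θ') (fun p => by simp [h2, h4])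
      fun p hp q _ => (hiff2 _ _).trans (hiff p q hp.2.1 hp.2.2),
    fun z => by simp [h3, h1], fun z hz => hW2 z hz, hbr⟩

end Summit.AtomisticToContinuum.Crystallization.Theorems.ChartedZeroExcessLayeredLatticeLiouville
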